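import Mathlib
import Summits.NavierStokesRegularity.NavierStokesRegularity.Theorems.EulerZoomLiouvillePowerGaugeEulerLiouvilleSelfSimilarKelvinFlowC2
import Literature.Analysis.FluidPDE.SelfSimilarEulerOutgoingExclusionTools

/-!
# THE FAST-TIME BOUND along confined backward orbits of a self-similar Euler profile (ROUND-39 (F), nsreg-p2 g33)

The residence clock `hclock` of `NeedleRace.curl_eq_zero_of_powerClock_of_strongThinExits` (…NeedleClockThreshold) asks how
long backward similarity orbits `σ ↦ Φ^V_{−σ} y` of a cut-off copy `V` of the profile can LINGER in `B̄_M` (`M = 2R`).  This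
file bounds the part of that residence time spent where the transport field `W = γy + U` is NOT small — the FAST TIME — by
the Bernoulli gain along the orbit:

* `bernoulli_comp_sub_eq_of_Icc`: the interval form of the Bernoulli transport identity (CIV (3.31)): along any solution of
  `Y′ = s·W(Y)` on `[a, b]`, `ℋ(Y b) − ℋ(Y a) = s(2γ−1)∫_a^b ‖W(Y t)‖² dt` (the tree's `HalfOrbit.bernoulli_comp_sub_eq_of_Ici`
  needs the ODE on all of `[0, ∞)`; a lingering cut-off orbit solves the TRUE transport ODE only while it stays where `V = U`);
* `bernoulli_gain_eq_of_linger`: for a `C¹` cut-off `V` (`‖DV‖ ≤ K`, `V = U` on `ball 0 R_big`, `M < R_big`) and a label `y`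
  lingering in `B̄_M` during `[0, L]`: `ℋ(Φ^V_{−L} y) − ℋ(y) = (1 − 2γ) ∫_0^L ‖W(Φ^V_{−σ} y)‖² dσ` — in particular `ℋ` does
  not decrease along backward orbits when `γ ≤ ½` (`bernoulli_le_of_linger`);
* `volume_fastTime_le_of_linger` (**the fast-time bound**): for `γ < ½` and `δ > 0`,
  `vol {σ ∈ [0, L] : δ ≤ ‖W(Φ^V_{−σ} y)‖} ≤ ofReal ((ℋ(Φ^V_{−L} y) − ℋ(y)) / ((1−2γ)δ²))` (Chebyshev in time);
* `volume_fastTime_le_of_linger'`: the same with the label-free constant `2·sup_{B̄_M}|ℋ| / ((1−2γ)δ²)`.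

Hence residence beyond `osc_{B̄_{2R}} ℋ / ((1−2γ)δ²)` is HOVERING TIME in `{‖W‖ < δ}` (ROUND-39 §1 (F)/(R)): with `γ = 1/(2+ρ)`,
`1 − 2γ = ργ`, and a Bernoulli oscillation `osc_{B̄_{2R}} ℋ ≤ C R^θ` the fast time is `≤ C R^θ/(ργδ²)` — kill-side of the
threshold `2+ρ` iff `θ < 2+ρ`.  No growth, symmetry or pressure hypothesis; not NS, not E. [folklore; CIV (3.31)]
-/

open Set Filter Topology Metric Function MeasureTheory InnerProductSpace
open scoped RealInnerProductSpace NNReal ENNReal Interval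

set_option linter.dupNamespace false

namespace Summit.NavierStokesRegularity.NavierStokesRegularity.Theorems.PowerGaugeEulerLiouville.NeedleClock

open Literature.Analysis Literature.Analysis.FluidPDE
open Summit.NavierStokesRegularity.NavierStokesRegularity.Theorems.PowerGaugeEulerLiouville

variable {γ : ℝ} {U V : EuclideanSpace ℝ (Fin 3) → EuclideanSpace ℝ (Fin 3)} {P : EuclideanSpace ℝ (Fin 3) → ℝ}

/-- **Bernoulli transport identity on an interval.**  If `Y′(t) = s·W(Y t)` for `t ∈ [a, b]` (`W = γ(y−c)+U` the transport
field of a profile `(U, P)`), then `ℋ(Y b) − ℋ(Y a) = s(2γ−1)∫_a^b ‖W(Y t)‖²`.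
[cite: ConstantinIgnatovaVicol2026Putative, §3.4.3 eq. (3.31)] -/
theorem bernoulli_comp_sub_eq_of_Icc {c : EuclideanSpace ℝ (Fin 3)} (h : IsSelfSimilarEulerProfile γ c U P) {s : ℝ}
    {Y : ℝ → EuclideanSpace ℝ (Fin 3)} {a b : ℝ} (hab : a ≤ b)
    (hY : ∀ t ∈ Icc a b, HasDerivAt Y (s • selfSimilarTransport γ c U (Y t)) t) :
    selfSimilarBernoulli γ c U P (Y b) - selfSimilarBernoulli γ c U P (Y a) =
      s * (2 * γ - 1) * ∫ t in a..b, ‖selfSimilarTransport γ c U (Y t)‖ ^ 2 := by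
  have hYc : ContinuousOn Y (Icc a b) := fun t ht => (hY t ht).continuousAt.continuousWithinAt
  have hWc : Continuous (selfSimilarTransport γ c U) := by
    have e : selfSimilarTransport γ c U = fun y => γ • (y - c) + U y := rfl
    rw [e]; exact ((continuous_id.sub continuous_const).const_smul γ).add h.contDiff_velocity.continuous
  have hgc : ContinuousOn (fun t => s * ((2 * γ - 1) * ‖selfSimilarTransport γ c U (Y t)‖ ^ 2)) (uIcc a b) := by
    rw [uIcc_of_le hab]
    exact continuousOn_const.mul (continuousOn_const.mul ((hWc.comp_continuousOn hYc).norm.pow 2))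
  have hHd : Differentiable ℝ (selfSimilarBernoulli γ c U P) :=
    h.contDiff_selfSimilarBernoulli.differentiable one_ne_zero
  have hder : ∀ t ∈ uIcc a b, HasDerivAt (fun r => selfSimilarBernoulli γ c U P (Y r))
      (s * ((2 * γ - 1) * ‖selfSimilarTransport γ c U (Y t)‖ ^ 2)) t := by
    intro t ht
    rw [uIcc_of_le hab] at ht
    have h1 : HasDerivAt (fun r => selfSimilarBernoulli γ c U P (Y r))
        (fderiv ℝ (selfSimilarBernoulli γ c U P) (Y t) (s • selfSimilarTransport γ c U (Y t))) t :=
      (hHd (Y t)).hasFDerivAt.comp_hasDerivAt t (hY t ht)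
    rw [map_smul, h.fderiv_selfSimilarBernoulli_transport (Y t), smul_eq_mul] at h1
    exact h1
  have key := intervalIntegral.integral_eq_sub_of_hasDerivAt hder (hgc.intervalIntegrable)
  rw [← key, intervalIntegral.integral_const_mul, intervalIntegral.integral_const_mul, mul_assoc]

/-- **Bernoulli gain along a lingering cut-off orbit.**  `V` a `C¹` field with `‖DV‖ ≤ K` agreeing with the profile velocity `U`
on `ball 0 R_big ⊃ B̄_M`; a label `y` whose backward `V`-orbit stays in `B̄_M` during `[0, L]` satisfies
`ℋ(Φ_{−L} y) − ℋ(y) = (1 − 2γ) ∫_0^L ‖W_U(Φ_{−σ} y)‖² dσ`. [folklore; CIV (3.31)] -/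
theorem bernoulli_gain_eq_of_linger (hprof : IsSelfSimilarEulerProfile γ 0 U P) (hV : ContDiff ℝ 1 V) {K : ℝ}
    (hK : ∀ y, ‖fderiv ℝ V y‖ ≤ K) {M Rbig : ℝ} (hMR : M < Rbig)
    (hVU : ∀ w ∈ ball (0 : EuclideanSpace ℝ (Fin 3)) Rbig, V w = U w) {y : EuclideanSpace ℝ (Fin 3)} {L : ℝ}
    (hL : 0 ≤ L)
    (hy : ∀ σ ∈ Icc (0 : ℝ) L, ‖ODE.evolutionMap (fun _ : ℝ => selfSimilarTransport γ 0 V) 0 (-σ) y‖ ≤ M) :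
    selfSimilarBernoulli γ 0 U P (ODE.evolutionMap (fun _ : ℝ => selfSimilarTransport γ 0 V) 0 (-L) y) -
        selfSimilarBernoulli γ 0 U P y =
      (1 - 2 * γ) * ∫ σ in (0 : ℝ)..L,
        ‖selfSimilarTransport γ 0 U (ODE.evolutionMap (fun _ : ℝ => selfSimilarTransport γ 0 V) 0 (-σ) y)‖ ^ 2 := by
  set Z : ℝ → EuclideanSpace ℝ (Fin 3) :=
    fun σ => ODE.evolutionMap (fun _ : ℝ => selfSimilarTransport γ 0 V) 0 (-σ) y with hZ
  -- inside `B̄_M ⊂ ball 0 R_big` the cut-off transport field IS the profile's transport field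
  have hWeq : ∀ σ ∈ Icc (0 : ℝ) L, selfSimilarTransport γ 0 V (Z σ) = selfSimilarTransport γ 0 U (Z σ) := by
    intro σ hσ
    have hmem : Z σ ∈ ball (0 : EuclideanSpace ℝ (Fin 3)) Rbig :=
      mem_ball_zero_iff.2 (lt_of_le_of_lt (hy σ hσ) hMR)
    simp only [selfSimilarTransport_apply, hVU _ hmem]
  have hder : ∀ σ ∈ Icc (0 : ℝ) L, HasDerivAt Z ((-1 : ℝ) • selfSimilarTransport γ 0 U (Z σ)) σ := by
    intro σ hσ
    have h1 := C2.Kelvin.hasDerivAt_flow_neg (γ := γ) hV hK y σ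
    rw [hWeq σ hσ] at h1
    exact h1
  have e := bernoulli_comp_sub_eq_of_Icc hprof hL hder
  have hZ0 : Z 0 = y := by simp [hZ, ODE.evolutionMap_self]
  rw [hZ0] at e
  rw [e]; ring

/-- `ℋ` does not decrease along lingering backward orbits when `γ ≤ ½`. [folklore; CIV (3.33)] -/
theorem bernoulli_le_of_linger (hprof : IsSelfSimilarEulerProfile γ 0 U P) (hγ2 : γ ≤ 1 / 2) (hV : ContDiff ℝ 1 V)
    {K : ℝ} (hK : ∀ y, ‖fderiv ℝ V y‖ ≤ K) {M Rbig : ℝ} (hMR : M < Rbig)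
    (hVU : ∀ w ∈ ball (0 : EuclideanSpace ℝ (Fin 3)) Rbig, V w = U w) {y : EuclideanSpace ℝ (Fin 3)} {L : ℝ}
    (hL : 0 ≤ L)
    (hy : ∀ σ ∈ Icc (0 : ℝ) L, ‖ODE.evolutionMap (fun _ : ℝ => selfSimilarTransport γ 0 V) 0 (-σ) y‖ ≤ M) :
    selfSimilarBernoulli γ 0 U P y ≤
      selfSimilarBernoulli γ 0 U P (ODE.evolutionMap (fun _ : ℝ => selfSimilarTransport γ 0 V) 0 (-L) y) := by
  have e := bernoulli_gain_eq_of_linger hprof hV hK hMR hVU hL hy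
  have hI : 0 ≤ ∫ σ in (0 : ℝ)..L,
      ‖selfSimilarTransport γ 0 U (ODE.evolutionMap (fun _ : ℝ => selfSimilarTransport γ 0 V) 0 (-σ) y)‖ ^ 2 :=
    intervalIntegral.integral_nonneg hL fun σ _ => by positivity
  have h12 : 0 ≤ 1 - 2 * γ := by linarith
  nlinarith [mul_nonneg h12 hI]

/-- **THE FAST-TIME BOUND.**  For `γ < ½`, a `C¹` cut-off copy `V` of the profile velocity beyond `B̄_M`, a label `y` lingering
in `B̄_M` during `[0, L]`, and `δ > 0`: the time spent where `‖W_U‖ ≥ δ` is at most the Bernoulli gain over `(1−2γ)δ²`.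
[folklore; CIV (3.31) + Chebyshev] -/
theorem volume_fastTime_le_of_linger (hprof : IsSelfSimilarEulerProfile γ 0 U P) (hγ2 : γ < 1 / 2)
    (hV : ContDiff ℝ 1 V) {K : ℝ} (hK : ∀ y, ‖fderiv ℝ V y‖ ≤ K) {M Rbig : ℝ} (hMR : M < Rbig)
    (hVU : ∀ w ∈ ball (0 : EuclideanSpace ℝ (Fin 3)) Rbig, V w = U w) {y : EuclideanSpace ℝ (Fin 3)} {L : ℝ}
    (hL : 0 ≤ L)
    (hy : ∀ σ ∈ Icc (0 : ℝ) L, ‖ODE.evolutionMap (fun _ : ℝ => selfSimilarTransport γ 0 V) 0 (-σ) y‖ ≤ M)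
    {δ : ℝ} (hδ : 0 < δ) :
    volume {σ ∈ Icc (0 : ℝ) L | δ ≤
        ‖selfSimilarTransport γ 0 U (ODE.evolutionMap (fun _ : ℝ => selfSimilarTransport γ 0 V) 0 (-σ) y)‖} ≤
      ENNReal.ofReal
        ((selfSimilarBernoulli γ 0 U P (ODE.evolutionMap (fun _ : ℝ => selfSimilarTransport γ 0 V) 0 (-L) y) -
            selfSimilarBernoulli γ 0 U P y) / ((1 - 2 * γ) * δ ^ 2)) := by
  set Z : ℝ → EuclideanSpace ℝ (Fin 3) :=
    fun σ => ODE.evolutionMap (fun _ : ℝ => selfSimilarTransport γ 0 V) 0 (-σ) y with hZ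
  set f : ℝ → ℝ := fun σ => ‖selfSimilarTransport γ 0 U (Z σ)‖ ^ 2 with hf
  have h12 : 0 < 1 - 2 * γ := by linarith
  -- continuity of the integrand
  have hZc : Continuous Z := by
    have hc := fun σ => (C2.Kelvin.hasDerivAt_flow_neg (γ := γ) hV hK y σ).continuousAt
    exact continuous_iff_continuousAt.2 hc
  have hWc : Continuous (selfSimilarTransport γ 0 U) := by
    have e : selfSimilarTransport γ 0 U = fun y => γ • (y - 0) + U y := rfl
    rw [e]; exact ((continuous_id.sub continuous_const).const_smul γ).add hprof.contDiff_velocity.continuous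
  have hfc : Continuous f := ((hWc.comp hZc).norm.pow 2)
  have hf0 : ∀ σ, 0 ≤ f σ := fun σ => by positivity
  -- the gain identity
  have e := bernoulli_gain_eq_of_linger hprof hV hK hMR hVU hL hy
  have hI : ∫ σ in (0 : ℝ)..L, f σ =
      (selfSimilarBernoulli γ 0 U P (Z L) - selfSimilarBernoulli γ 0 U P y) / (1 - 2 * γ) := by
    rw [eq_div_iff h12.ne', mul_comm]; exact e.symm
  -- Chebyshev in time on `[0, L]`
  have hmeas : MeasurableSet {σ : ℝ | δ ≤ ‖selfSimilarTransport γ 0 U (Z σ)‖} :=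
    (isClosed_le continuous_const (hWc.comp hZc).norm).measurableSet
  have hset : {σ ∈ Icc (0 : ℝ) L | δ ≤ ‖selfSimilarTransport γ 0 U (Z σ)‖} ⊆
      {σ | ENNReal.ofReal (δ ^ 2) ≤ ENNReal.ofReal (f σ)} ∩ Icc (0 : ℝ) L := by
    rintro σ ⟨hσ, hδσ⟩
    refine ⟨?_, hσ⟩
    show ENNReal.ofReal (δ ^ 2) ≤ ENNReal.ofReal (‖selfSimilarTransport γ 0 U (Z σ)‖ ^ 2)
    exact ENNReal.ofReal_le_ofReal (pow_le_pow_left₀ hδ.le hδσ 2)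
  have hcheb : ENNReal.ofReal (δ ^ 2) * volume ({σ | ENNReal.ofReal (δ ^ 2) ≤ ENNReal.ofReal (f σ)} ∩ Icc (0 : ℝ) L) ≤
      ∫⁻ σ in Icc (0 : ℝ) L, ENNReal.ofReal (f σ) := by
    rw [← Measure.restrict_apply' measurableSet_Icc]
    exact mul_meas_ge_le_lintegral₀ (hfc.measurable.ennreal_ofReal.aemeasurable) _
  have hlin : ∫⁻ σ in Icc (0 : ℝ) L, ENNReal.ofReal (f σ) = ENNReal.ofReal (∫ σ in (0 : ℝ)..L, f σ) := by
    rw [intervalIntegral.integral_of_le hL, ← integral_Icc_eq_integral_Ioc,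
      ← ofReal_integral_eq_lintegral_ofReal (hfc.integrableOn_Icc) (Eventually.of_forall hf0)]
  have hδ2 : 0 < δ ^ 2 := by positivity
  have hmain : ENNReal.ofReal (δ ^ 2) * volume {σ ∈ Icc (0 : ℝ) L | δ ≤ ‖selfSimilarTransport γ 0 U (Z σ)‖} ≤
      ENNReal.ofReal ((selfSimilarBernoulli γ 0 U P (Z L) - selfSimilarBernoulli γ 0 U P y) / (1 - 2 * γ)) := by
    calc ENNReal.ofReal (δ ^ 2) * volume {σ ∈ Icc (0 : ℝ) L | δ ≤ ‖selfSimilarTransport γ 0 U (Z σ)‖}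
        ≤ ENNReal.ofReal (δ ^ 2) *
            volume ({σ | ENNReal.ofReal (δ ^ 2) ≤ ENNReal.ofReal (f σ)} ∩ Icc (0 : ℝ) L) :=
          by gcongr
      _ ≤ ∫⁻ σ in Icc (0 : ℝ) L, ENNReal.ofReal (f σ) := hcheb
      _ = _ := by rw [hlin, hI]
  have hne : ENNReal.ofReal (δ ^ 2) ≠ 0 := (ENNReal.ofReal_pos.2 hδ2).ne'
  calc volume {σ ∈ Icc (0 : ℝ) L | δ ≤ ‖selfSimilarTransport γ 0 U (Z σ)‖}
      ≤ ENNReal.ofReal ((selfSimilarBernoulli γ 0 U P (Z L) - selfSimilarBernoulli γ 0 U P y) / (1 - 2 * γ)) /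
          ENNReal.ofReal (δ ^ 2) := by
        rw [ENNReal.le_div_iff_mul_le (Or.inl hne) (Or.inl ENNReal.ofReal_ne_top), mul_comm]
        exact hmain
    _ = ENNReal.ofReal ((selfSimilarBernoulli γ 0 U P (Z L) - selfSimilarBernoulli γ 0 U P y) /
          ((1 - 2 * γ) * δ ^ 2)) := by
        rw [← ENNReal.ofReal_div_of_pos hδ2, div_div]

/-- **THE FAST-TIME BOUND, label-free form.**  With `Θ := 2·sup_{B̄_M}|ℋ|` (finite by compactness): for every cut-off copy,
every label lingering in `B̄_M` during `[0, L]` and every `δ > 0`, the fast time is at most `Θ / ((1−2γ)δ²)` — independent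
of `L`.  Residence beyond that is hovering time in `{‖W‖ < δ}`. [folklore; CIV (3.31)–(3.33)] -/
theorem volume_fastTime_le_of_linger' (hprof : IsSelfSimilarEulerProfile γ 0 U P) (hγ2 : γ < 1 / 2) (M : ℝ) :
    ∃ Θ : ℝ, 0 ≤ Θ ∧ ∀ (V : EuclideanSpace ℝ (Fin 3) → EuclideanSpace ℝ (Fin 3)) (K Rbig : ℝ),
      ContDiff ℝ 1 V → (∀ y, ‖fderiv ℝ V y‖ ≤ K) → M < Rbig →
      (∀ w ∈ ball (0 : EuclideanSpace ℝ (Fin 3)) Rbig, V w = U w) →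
      ∀ (y : EuclideanSpace ℝ (Fin 3)) (L : ℝ), 0 ≤ L →
      (∀ σ ∈ Icc (0 : ℝ) L, ‖ODE.evolutionMap (fun _ : ℝ => selfSimilarTransport γ 0 V) 0 (-σ) y‖ ≤ M) →
      ∀ δ : ℝ, 0 < δ →
      volume {σ ∈ Icc (0 : ℝ) L | δ ≤
          ‖selfSimilarTransport γ 0 U (ODE.evolutionMap (fun _ : ℝ => selfSimilarTransport γ 0 V) 0 (-σ) y)‖} ≤
        ENNReal.ofReal (Θ / ((1 - 2 * γ) * δ ^ 2)) := by
  obtain ⟨B, hB⟩ := (isCompact_closedBall (0 : EuclideanSpace ℝ (Fin 3)) M).exists_bound_of_continuousOn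
    hprof.contDiff_selfSimilarBernoulli.continuous.continuousOn
  have hB' : ∀ x ∈ closedBall (0 : EuclideanSpace ℝ (Fin 3)) M, ‖selfSimilarBernoulli γ 0 U P x‖ ≤ max B 0 :=
    fun x hx => (hB x hx).trans (le_max_left _ _)
  refine ⟨2 * max B 0, by positivity, ?_⟩
  intro V K Rbig hV hK hMR hVU y L hL hy δ hδ
  have h12 : 0 < 1 - 2 * γ := by linarith
  have hδ2 : 0 < δ ^ 2 := by positivity
  refine (volume_fastTime_le_of_linger hprof hγ2 hV hK hMR hVU hL hy hδ).trans (ENNReal.ofReal_le_ofReal ?_)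
  refine div_le_div_of_nonneg_right ?_ (by positivity)
  have hyM : y ∈ closedBall (0 : EuclideanSpace ℝ (Fin 3)) M := by
    have h0 := hy 0 ⟨le_refl 0, hL⟩
    rw [neg_zero] at h0
    simpa [ODE.evolutionMap_self, mem_closedBall_zero_iff] using h0
  have hLM : ODE.evolutionMap (fun _ : ℝ => selfSimilarTransport γ 0 V) 0 (-L) y ∈
      closedBall (0 : EuclideanSpace ℝ (Fin 3)) M := mem_closedBall_zero_iff.2 (hy L ⟨hL, le_refl L⟩)
  have h1 := hB' _ hLM
  have h2 := hB' _ hyM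
  rw [Real.norm_eq_abs] at h1 h2
  linarith [(abs_le.1 h1).2, (abs_le.1 h2).1]

end Summit.NavierStokesRegularity.NavierStokesRegularity.Theorems.PowerGaugeEulerLiouville.NeedleClock
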